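import Summits.CriticalPhenomena.PercolationContinuityZ3.Theses.PercLowPointHalfSpace
import Summits.CriticalPhenomena.PercolationContinuityZ3.Cruxes.LowPointBookkeeping.Disproof

/-!
# Sketch — crux-ideate round 2, ideator 4, crux K = `LowPointBookkeeping` (stmt-CriticalPhenomena-14713)

Idea card `cube-exit-stem-criterion`.  Nothing below is proved (statements `sorry`ed by design); the point is
that the first checkable statements of the line elaborate over existing declarations.

Objects (bond percolation on `ℤ³` at `p_c`, `ℍ = {x₀ ≥ 0}`, `U = C_ℍ(0)`):
* `cube c r`        — the sup-norm box `c + [-r, r]³`;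
* `locWallConn r`   — the point `x* = r e₀` is joined to the floor `∂ℍ` by an open path INSIDE the box
                      `x* + [-r,r]³` (which lies in `ℍ`, bottom face on the floor): the LOCALISED point-to-wall event;
* `locFoot r ω`     — the LOCAL footprint of `U`: floor points joined to `0` inside `B_r(0) ∩ ℍ`;
* `massIn n ω`      — `|U ∩ B_n|`;  `tall r` — the route's arm event `{U reaches sup-distance ≥ r}`.
Statements:
* `cube_exit`            — θ(p_c) ≤ 6 · P(locWallConn r) for every r ≥ 1 (six faces of the cube + symmetry; the
                           in-house fact (F2) of card halfspace-box-trace-facts, here as an UPPER-bound device);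
* `stem_criterion`       — THE LEMMA OF THE LINE: for all R ≥ 1, φ ≥ 0,
      θ(p_c) · R ≤ 6 · [ R^{-φ} E(|U ∩ B_{4R}| ; tall R) + E(|U ∩ B_{2R}| ; tall R, |locFoot R| < (2R)^φ) ]
  (cube exit + footprint-NORMALISED local horizontal mass transport + fat/thin split of the exit foot);
* `Bwide`, `QuantC a`, `StemLight φ` — the three ONE-cluster inputs, and the composition
  `continuity_of_stemLight : Bwide → QuantC a → StemLight φ → 7/4 < a + φ → PercolationContinuityZ3`.
-/

noncomputable section

namespace Summit.CriticalPhenomena.PercolationContinuityZ3.Cruxes.LowPointBookkeeping.Ideas4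

open MeasureTheory Filter Topology
open Literature.Probability.Percolation Literature.Probability.LatticeModels
open Summit.CriticalPhenomena.PercolationContinuityZ3.Theses.PercLowPointHalfSpace
open scoped Classical

/-- The critical bond percolation measure on `ℤ³`. -/
abbrev μc : Measure (BondConfig (Site 3)) := bondPercolation (zdGraph 3) (criticalProbI 3)

/-- The half-space `ℍ = {x₀ ≥ 0}`. -/
abbrev Hs : Set (Site 3) := {x | 0 ≤ x 0}

/-- The sup-norm box `c + [-r, r]³`. -/
def cube (c : Site 3) (r : ℕ) : Set (Site 3) := {y | ∀ i : Fin 3, |y i - c i| ≤ r}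

/-- The apex `x* = r e₀` (height `r` above the floor origin). -/
def apex (r : ℕ) : Site 3 := Pi.single 0 (r : ℤ)

/-- LOCALISED point-to-wall event: `x* = r e₀` is joined to some floor point by an open path all of whose
vertices lie in the box `x* + [-r,r]³` (a subset of `ℍ` whose bottom face lies on the floor `∂ℍ`). -/
def locWallConn (r : ℕ) : Set (BondConfig (Site 3)) :=
  {ω | ∃ f : Site 3, f 0 = 0 ∧ ω ∈ openConnIn (cube (apex r) r) (apex r) f}

/-- **Cube exit** (first lemma, provable now; M-sized): `θ(p_c) ≤ 6 · P(locWallConn r)` for every `r ≥ 1`.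
Proof: `{|C(0)| = ∞} ⊆ {0 ↔ ∂B_r inside B_r} ⊆ ⋃_{six faces} {0 ↔ face inside B_r}`; the six face events are
images of one another under the coordinate permutations / reflections of `ℤ³` (measure-preserving,
`LatticeSymmetry` / `BondPercolationSymmetry`), so each has probability `≥ θ/6`; the bottom-face event, shifted
up by `r e₀`, is `locWallConn r`.  (In-house: card halfspace-box-trace-facts (F2), with the square-root trick.) -/
theorem cube_exit (r : ℕ) (hr : 1 ≤ r) :
    theta (zdGraph 3) (0 : Site 3) (criticalProbI 3) ≤ 6 * μc.real (locWallConn r) := by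
  sorry

/-- The LOCAL footprint of the wall cluster at scale `r`: floor points joined to `0` INSIDE `B_r(0) ∩ ℍ`. -/
def locFoot (r : ℕ) (ω : BondConfig (Site 3)) : Set (Site 3) :=
  {f | f 0 = 0 ∧ ω ∈ openConnIn (cube 0 r ∩ Hs) 0 f}

/-- `|U ∩ B_n|`, the in-box mass of the wall cluster `U = C_ℍ(0)`. -/
def massIn (n : ℕ) (ω : BondConfig (Site 3)) : ℕ :=
  ((box 3 n).filter fun x => ω ∈ openConnIn Hs 0 x).card

/-- The route's arm event: `U` reaches sup-distance `≥ r` (verbatim the event of `QuantitativeBGN`). -/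
def tall (r : ℕ) : Set (BondConfig (Site 3)) :=
  {ω | ∃ y : Site 3, (∃ i : Fin 3, (r : ℤ) ≤ |y i|) ∧ ω ∈ openConnIn Hs 0 y}

/-- The thin-stem event at scale `R`, depth exponent `φ`: fewer than `(2R)^φ` LOCAL feet. -/
def thinStem (R : ℕ) (φ : ℝ) : Set (BondConfig (Site 3)) :=
  {ω | (locFoot R ω).encard < (⌈(2 * (R : ℝ)) ^ φ⌉₊ : ℕ∞)}

/-- **STEM CRITERION** (the lemma of the line; provable now, L-sized; no percolation input beyond cube exit,
horizontal translation invariance, Tonelli):  for all `R ≥ 1`, `φ ≥ 0`,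
`θ(p_c) · R ≤ 6 · [ R^{-φ} · E(|U ∩ B_{4R}| ; tall R) + E(|U ∩ B_{2R}| ; tall R ∧ thinStem R φ) ]`.
Proof sketch: for each `r ∈ [R, 2R)`, `θ/6 ≤ P(locWallConn r)` (cube exit); write `P(locWallConn r)` as a
footprint-normalised horizontal mass transport from the apex to the feet joined to it inside `B_{2r}(apex) ∩ ℍ`,
shift each foot to the origin, and bound the normalising footprint below by the local footprint
`locFoot r (exit foot)` (`B_r(exit foot) ⊆ B_{2r}(apex)`); split on `|locFoot| ≥ r^φ` (gives
`r^{-φ} E|U ∩ L_r ∩ B_{2r}|`) or `< r^φ` (re-root at the thin exit foot; the normalisation cancels the sum over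
receivers exactly, giving `E(|U ∩ L_r ∩ B_r| ; thinStem)`); sum over `r ∈ [R,2R)`. -/
theorem stem_criterion (R : ℕ) (hR : 1 ≤ R) (φ : ℝ) (hφ : 0 ≤ φ) :
    theta (zdGraph 3) (0 : Site 3) (criticalProbI 3) * R ≤
      6 * ((R : ℝ) ^ (-φ) * ∫ ω in tall R, (massIn (4 * R) ω : ℝ) ∂μc
            + ∫ ω in tall R ∩ thinStem R φ, (massIn (2 * R) ω : ℝ) ∂μc) := by
  sorry

/-- Input 1 (one-cluster, first moment): the route's `TallClusterMassBound` TYPED ON THE WIDE BALL —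
`E(|U ∩ B_{4r}| ; U r-tall) ≤ C r^{11/4} π_s(r)` (same exponent, same sources, same MC margin 0.22; repairs the
matched-scale artefact of B, which bounds only `|U ∩ B_r|`). -/
def Bwide : Prop :=
  ∃ C : ℝ, ∀ r : ℕ, 1 ≤ r →
    ∫ ω in tall r, (massIn (4 * r) ω : ℝ) ∂μc ≤ C * (r : ℝ) ^ ((11 : ℝ) / 4) * μc.real (tall r)

/-- Input 2 (one-cluster): quantitative BGN with a NAMED exponent `a` (the route's `QuantitativeBGN` is `∃ a > 0`). -/
def QuantC (a : ℝ) : Prop :=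
  ∃ C : ℝ, ∀ r : ℕ, 1 ≤ r → μc.real (tall r) ≤ C * (r : ℝ) ^ (-a)

/-- Input 3 (one-cluster, first moment): **StemLight(φ)** — thin-stemmed tall wall clusters carry vanishing level
density: `R^{-1} E(|U ∩ B_{2R}| ; U R-tall, |locFoot R| < (2R)^φ) → 0` (a `liminf = 0` version suffices). -/
def StemLight (φ : ℝ) : Prop :=
  Tendsto (fun R : ℕ => (R : ℝ)⁻¹ * ∫ ω in tall R ∩ thinStem R φ, (massIn (2 * R) ω : ℝ) ∂μc) atTop (𝓝 0)

/-- **Composition** (S-sized real analysis from `stem_criterion`): `θ ≤ 6 C C' R^{7/4 - a - φ} + 6 R^{-1} S_φ(R)`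
for all `R`, and both terms tend to `0`. -/
theorem continuity_of_stemLight {a φ : ℝ} (hB : Bwide) (hC : QuantC a) (hS : StemLight φ) (hφ : 0 ≤ φ)
    (h : (7 : ℝ) / 4 < a + φ) : _root_.PercolationContinuityZ3 := by
  sorry

/-- How the crux K relates (remark): K follows from `(B → Bwide)`, `(C → QuantC a)` with `a > 7/4 - φ`, and
`StemLight φ`; of these only the first is a plausible LEMMA (and only with a loss `r^{1/8}` by the extremal-shell
slack of B's typing), the other two are hypotheses STRONGER than the crux's own — so this is a RESTATEMENT
proposal (R6 = {Bwide, QuantC a, StemLight φ, a + φ > 7/4}), not a K-line; see the card's Transfer field. -/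
theorem lowPointBookkeeping_of_inputs {a φ : ℝ} (hBw : TallClusterMassBound → Bwide)
    (hCq : QuantitativeBGN → QuantC a) (hS : StemLight φ) (hφ : 0 ≤ φ) (h : (7 : ℝ) / 4 < a + φ) :
    LowPointBookkeeping := by
  intro _hA hB hC
  have hcont : _root_.PercolationContinuityZ3 := continuity_of_stemLight (hBw hB) (hCq hC) hS hφ h
  -- conjunct → axis decay: cdisprove's `Disproof.axisDecayAt_criticalProbI_iff` (kernel-checked, Cruxes/…/Disproof.lean)
  exact (Summit.CriticalPhenomena.PercolationContinuityZ3.Cruxes.LowPointBookkeeping.Disproof.axisDecayAt_criticalProbI_iff).2 hcont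

end Summit.CriticalPhenomena.PercolationContinuityZ3.Cruxes.LowPointBookkeeping.Ideas4

end
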